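import Literature.IUT.LogVolume.Corollary22PartIILemmas
import Literature.NumberTheory.DiophantineGeometry.GenEllConductorDifferent
import HarnessLib

/-!
# [IUTchIV] Theorem 1.10, Step (ii), first display — for the REAL tower `F_tpd ⊆ F` of the `λ`-line

Mochizuki, *Inter-universal Teichmüller theory IV*, RIMS manuscript (Apr. 2020; = PRIMS **57** (2021)),
proof of Thm. 1.10, Step (ii), p. 24:

> "Next, let us observe that the inequality `log(𝔡^{F_tpd}) + log(𝔣^{F_tpd}) ≤ log(𝔡^F) + log(𝔣^F)`
> follows immediately from Proposition 1.3, (i), and the various definitions involved."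

Here the four numbers are those of the statement of Thm. 1.10 (p. 23): `log(𝔡^{F□}) := deg(𝔡^{F□}_ADiv)`
(normalized degree of the different of `F□`), `log(𝔣^{F□}) := deg(𝔣^{F□}_ADiv)` with `𝔣^{F□}_ADiv` "the
effective arithmetic divisor whose support coincides with `Supp(𝔮^{F□}_ADiv)`, but all of whose
coefficients are equal to `1` — i.e., the conductor", supported on `𝕍(F□)^bad := 𝕍^bad_mod ×_{𝕍_mod} 𝕍(F□)`.

In the tree `Theorem110Data.lean` carries this inequality as the INPUT field `ProofData.tpd_le_F` of the
abstract numerics, and `Theorem110StepII.lean` derives it from abstract per-place data. This file PROVES it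
for the REAL fields of a point `x_E = λ` of the `λ`-line (`F_tpd = ℚ(λ)`, the presenting field of
`P : NFPoint`; `𝕍(F_tpd)^bad` = the bad places of `λ` away from a finite set `S` of rational primes, as in
`Cor22.logCondAvoid`, `S = {2, l}` for the Θ-data of [IUTchIV] Cor. 2.2 (ii)) and ANY finite extension
`F ⊇ F_tpd` (in the application `F = F_tpd(√−1, E[3·5])`): with
`𝕍(F)^bad :=` the places of `F` over `𝕍(F_tpd)^bad` (`badPlacesOver`) and
`log(𝔣^F) := (1/[F:ℚ])·Σ_{w ∈ 𝕍(F)^bad} log N(w)` (`logCondOver`),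

  `log(𝔡^{F_tpd}) + log(𝔣^{F_tpd}) ≤ log(𝔡^F) + log(𝔣^F)`   (`logDiff_add_logCondAvoid_le`).

The number-field engine is the tree's conductor–different inequality
`GenEll.cond_sub_cond_le_logdisc_sub_logdisc` ([GenEll] Prop. 1.7 (i); Mathlib's transitivity of the
different and `pow_sub_one_dvd_differentIdeal` = "Proposition 1.3, (i)" globally: `ord_w 𝔡_{F/F_tpd} ≥
e(w|v) − 1`). Also recorded: `log(𝔣^F) ≤ log(𝔣^{F_tpd})` (normalized conductors do not grow,
`logCondOver_le_logCondAvoid`) and `log(𝔡^{F_tpd}) ≤ log(𝔡^F)`. Classical; TAKES NO SIDE on [IUTchIII]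
Cor. 3.12 (these are the "pass-through" classical fields of `Thm110Numerics.ProofData` for real fields;
the disputed input of Thm. 1.10 is elsewhere).
-/

noncomputable section

namespace Literature.IUT.LogVolume

namespace Cor22

open NumberField IsDedekindDomain Real Finset Ideal Module
open Literature.NumberTheory.DiophantineGeometry.GenEll

/-! ## The bad places of `F_tpd` away from `S`, and the places of `F` over them -/

open scoped Classical in
/-- `𝕍(F_tpd)^bad` for the Θ-data attached to `(x_E, S)`: the bad places of `λ` (poles of `j(λ)`) not
dividing the rational primes in `S` — the support of the tree's `Cor22.qDivisor P S` / `Cor22.condDivisor P S`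
([IUTchIV] Cor. 2.2 (P5) p. 46 with `S = {2, l}`). [claim: Mochizuki2012, status: disputed] -/
def badPlacesAvoid (P : NFPoint) (S : Finset ℕ) : Finset (HeightOneSpectrum (𝓞 P.F)) :=
  (badPlaces P).filter (fun v => ∀ p ∈ S, ((p : ℕ) : 𝓞 P.F) ∉ v.asIdeal)

open scoped Classical in
/-- `𝕍(F)^bad := 𝕍^bad_mod ×_{𝕍_mod} 𝕍(F)` ([IUTchIV] Thm. 1.10, p. 23): the (finitely many) places of `F`
lying over the bad places of `F_tpd` away from `S`. [claim: Mochizuki2012, status: disputed] -/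
def badPlacesOver (P : NFPoint) (S : Finset ℕ) (F : Type) [Field F] [NumberField F] [Algebra P.F F] :
    Finset (HeightOneSpectrum (𝓞 F)) :=
  (badPlacesAvoid P S).biUnion fun v =>
    (IsDedekindDomain.primesOverFinset v.asIdeal (𝓞 F)).preimage HeightOneSpectrum.asIdeal
      (fun _ _ _ _ h => HeightOneSpectrum.ext h)

/-- `log(𝔣^F) := deg(𝔣^F_ADiv)`, `𝔣^F_ADiv = Σ_{w ∈ 𝕍(F)^bad} w` the conductor ([IUTchIV] Thm. 1.10, p. 23):
`(1/[F:ℚ])·Σ_{w ∈ 𝕍(F)^bad} log N(w)`. [claim: Mochizuki2012, status: disputed] -/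
def logCondOver (P : NFPoint) (S : Finset ℕ) (F : Type) [Field F] [NumberField F] [Algebra P.F F] : ℝ :=
  (finrank ℚ F : ℝ)⁻¹ * ∑ w ∈ badPlacesOver P S F, Real.log (absNorm w.asIdeal : ℝ)

/-- A place of `F` lies in `𝕍(F)^bad` iff the place of `F_tpd` under it is bad (away from `S`).
[claim: Mochizuki2012, status: disputed] -/
theorem mem_badPlacesOver_iff {P : NFPoint} {S : Finset ℕ} {F : Type} [Field F] [NumberField F]
    [Algebra P.F F] (w : HeightOneSpectrum (𝓞 F)) :
    w ∈ badPlacesOver P S F ↔ w.under (𝓞 P.F) ∈ badPlacesAvoid P S := by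
  classical
  unfold badPlacesOver
  rw [Finset.mem_biUnion]
  constructor
  · rintro ⟨v, hv, hw⟩
    rw [Finset.mem_preimage, IsDedekindDomain.mem_primesOverFinset_iff v.ne_bot] at hw
    have heq : w.under (𝓞 P.F) = v := HeightOneSpectrum.ext hw.2.over.symm
    rwa [heq]
  · intro h
    refine ⟨w.under (𝓞 P.F), h, ?_⟩
    rw [Finset.mem_preimage, IsDedekindDomain.mem_primesOverFinset_iff (w.under (𝓞 P.F)).ne_bot]
    exact ⟨w.isPrime, ⟨rfl⟩⟩

/-- `log(𝔣^{F_tpd}) = (1/[F_tpd:ℚ])·Σ_{v ∈ 𝕍(F_tpd)^bad} log N(v)`. [claim: Mochizuki2012, status: disputed] -/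
theorem logCondAvoid_eq_sum (P : NFPoint) (S : Finset ℕ) :
    logCondAvoid P S = (P.degree : ℝ)⁻¹ * ∑ v ∈ badPlacesAvoid P S, Real.log (absNorm v.asIdeal : ℝ) := by
  classical
  unfold logCondAvoid condDivisor badPlacesAvoid NFPoint.degree
  rw [FinDivisor.ndeg_apply, FinDivisor.deg_sum_of, div_eq_inv_mul]
  congr 1
  exact Finset.sum_congr rfl fun v _ => one_mul _

/-- `log(𝔣^F) ≥ 0`. [claim: Mochizuki2012, status: disputed] -/
theorem logCondOver_nonneg (P : NFPoint) (S : Finset ℕ) (F : Type) [Field F] [NumberField F]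
    [Algebra P.F F] : 0 ≤ logCondOver P S F := by
  unfold logCondOver
  refine mul_nonneg (inv_nonneg.mpr (Nat.cast_nonneg _)) (Finset.sum_nonneg fun w _ => ?_)
  have h1 : (1 : ℝ) ≤ (absNorm w.asIdeal : ℕ) := by
    exact_mod_cast Nat.one_le_iff_ne_zero.mpr (Ideal.absNorm_eq_zero_iff.not.mpr w.ne_bot)
  exact Real.log_nonneg h1

/-! ## Step (ii), first display, for the real tower -/

/-- **[IUTchIV] Thm. 1.10, Step (ii), first display, for REAL fields** (p. 24: "`log(𝔡^{F_tpd}) +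
log(𝔣^{F_tpd}) ≤ log(𝔡^F) + log(𝔣^F)` follows immediately from Proposition 1.3, (i)"): for the point
`x_E = λ` presented over `F_tpd`, a finite set `S` of rational primes and any finite extension `F ⊇ F_tpd`,
`log-diff(F_tpd) + log(𝔣^{F_tpd}) ≤ log-diff(F) + log(𝔣^F)` — the gain in the different at each `w ∈ 𝕍(F)^bad`,
`ord_w(𝔡_{F/F_tpd}) ≥ e(w|v) − 1`, compensates the loss `[F:F_tpd]·log N(v) − Σ_{w∣v} log N(w)` in the
normalized conductor (the tree's `GenEll.cond_sub_cond_le_logdisc_sub_logdisc`). This is the field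
`ProofData.tpd_le_F` of `Theorem110Data.lean` for numerics built from these real fields.
[claim: Mochizuki2012, status: disputed] -/
theorem logDiff_add_logCondAvoid_le (P : NFPoint) (S : Finset ℕ) (F : Type) [Field F] [NumberField F]
    [Algebra P.F F] :
    P.logDiff + logCondAvoid P S ≤ (extend P F).logDiff + logCondOver P S F := by
  have hT : ∀ w : HeightOneSpectrum (𝓞 F), w.under (𝓞 P.F) ∈ badPlacesAvoid P S →
      w ∈ badPlacesOver P S F := fun w hw => (mem_badPlacesOver_iff w).mpr hw
  have h := cond_sub_cond_le_logdisc_sub_logdisc P.F F (badPlacesAvoid P S) (badPlacesOver P S F) hT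
  rw [logCondAvoid_eq_sum, NFPoint.logDiff_eq_log_discr, NFPoint.logDiff_eq_log_discr]
  unfold logCondOver NFPoint.degree extend
  dsimp only
  linarith

/-- **Normalized conductors do not grow**: `log(𝔣^F) ≤ log(𝔣^{F_tpd})` (`Σ_{w∣v} log N(w) = Σ_{w∣v} f_w·log N(v)
≤ [F:F_tpd]·log N(v)`; the tree's `GenEll.cond_above_le_cond`). [claim: Mochizuki2012, status: disputed] -/
theorem logCondOver_le_logCondAvoid (P : NFPoint) (S : Finset ℕ) (F : Type) [Field F] [NumberField F]
    [Algebra P.F F] : logCondOver P S F ≤ logCondAvoid P S := by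
  classical
  have h := cond_above_le_cond P.F F (badPlacesAvoid P S)
  rw [logCondAvoid_eq_sum]
  unfold logCondOver NFPoint.degree
  refine le_trans (le_of_eq ?_) h
  congr 1
  unfold badPlacesOver
  rw [Finset.sum_biUnion]
  · refine Finset.sum_congr rfl fun v _ => ?_
    refine Finset.sum_preimage HeightOneSpectrum.asIdeal _ _
      (fun w : Ideal (𝓞 F) => Real.log (absNorm w : ℝ)) ?_
    intro w hw hnot
    exfalso
    rw [IsDedekindDomain.mem_primesOverFinset_iff v.ne_bot] at hw
    exact hnot ⟨⟨w, hw.1, Ideal.ne_bot_of_mem_primesOver v.ne_bot hw⟩, rfl⟩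
  · intro v _ v' _ hne
    refine Finset.disjoint_left.mpr fun w hw hw' => hne ?_
    dsimp only at hw hw'
    rw [Finset.mem_preimage, IsDedekindDomain.mem_primesOverFinset_iff v.ne_bot] at hw
    rw [Finset.mem_preimage, IsDedekindDomain.mem_primesOverFinset_iff v'.ne_bot] at hw'
    exact HeightOneSpectrum.ext (hw.2.over.trans hw'.2.over.symm)

/-- `log-diff(F_tpd) ≤ log-diff(F)` for the extended point (the relative different is effective; the tree's
`GenEll.NFPoint.logDiff_le_logDiff_of_ringHom`). [claim: Mochizuki2012, status: disputed] -/
theorem logDiff_le_logDiff_extend (P : NFPoint) (F : Type) [Field F] [NumberField F] [Algebra P.F F] :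
    P.logDiff ≤ (extend P F).logDiff :=
  NFPoint.logDiff_le_logDiff_of_ringHom P (extend P F) (algebraMap P.F F)

end Cor22

end Literature.IUT.LogVolume

end
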